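import Literature.NumberTheory.BeurlingPrimes.HilberdinkMellin
import Literature.Analysis.FunctionSpaces.PlancherelL1L2
import Mathlib.Analysis.SpecialFunctions.JapaneseBracket
import Mathlib.Analysis.SpecialFunctions.Trigonometric.Bounds
import HarnessLib

/-!
# Hilberdink's uncertainty principle, VI: the dilation difference of `E` and Mellin–Plancherel

Topic `Literature/NumberTheory/BeurlingPrimes`, grouping namespace `Hilberdink`. Everything in this
file is PROVED. It is the first half of an `L²` replacement for the truncated-Perron / mean-value
step of Hilberdink 2005, §3 (proof of Theorem 1: "`∫_{−T}^{T} |ζ_N(σ+it)|² dt ≥ k₁TN^{1−2σ} −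
k₂N^{2−2σ}` … is incompatible with `ζ(σ+it) = O(|t|^ε)`"): we compare the two sides of the
**Mellin–Plancherel identity** (tree: `Literature.Analysis.FunctionSpaces.integral_norm_sq_mellin_eq`)
for the dilation difference
`G_ρ(x) = ρ^{−σ₁} E(ρx) − E(x)`, `E = 1_{(1,∞)}(N_P − a·x)` (`errN`, file II), `ρ = e^h`:
* `Hilberdink.dilErr P a σ₁ ρ = G_ρ`; it vanishes on `(0, 1/ρ]`, is bounded by `3C x^θ`
  (`norm_dilErr_le`), and `x ↦ ‖G_ρ(x)‖² x^{−2σ₁−1}` is integrable on `(0, ∞)` for `θ < σ₁`;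
* `Hilberdink.mellin_dilErr` — `mellin G_ρ (−σ₁ + iτ) = (ρ^{−iτ} − 1) · mellin E (−σ₁ + iτ)`,
  with `‖ρ^{−iτ} − 1‖ ≤ min(|τ|h, 2)`, whence `‖ρ^{−iτ} − 1‖² ≤ 4 (|τ| h)^{2γ}` for `0 ≤ γ ≤ 1`
  (`norm_sq_factor_le`);
* **`Hilberdink.integral_norm_sq_dilErr_le`** — if `‖mellin E (−σ₁ + iτ)‖ ≤ K(1+|τ|)^{ε−1}` for all
  `τ` (the zero-order input of file V) and `2γ + 2ε < 1`, then
  `2π ∫₀^∞ ‖G_ρ(x)‖² x^{−2σ₁−1} dx = ∫ ‖mellin G_ρ(−σ₁+iτ)‖² dτ ≤ 4K² I h^{2γ}`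
  with `I = ∫ (1+|τ|)^{2γ+2ε−2} dτ < ∞` (`0 < h ≤ 1`).
The matching lower bound `≫ X^{−2σ₁}` at `h = c₀/X`, from the jumps of `N_P`, is file VII.

## References
* [Hilberdink2005] T. W. Hilberdink, *Well-behaved Beurling primes and integers*, J. Number Theory
  112 (2005) 332–344, §3 (proof of Theorem 1: mean values versus zero order).
* E. C. Titchmarsh, *Introduction to the Theory of Fourier Integrals*, Thm. 71 (Parseval for Mellin
  transforms; tree `PlancherelL1L2.lean`).
-/

noncomputable section

open Set Filter MeasureTheory Complex Asymptotics
open scoped Topology Real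

namespace Literature.NumberTheory.BeurlingPrimes

open Literature.Barriers.RiemannHypothesis

namespace Hilberdink

variable {P : BeurlingPrimes} {a C θ σ₁ ρ : ℝ}

/-! ### The dilation difference `G_ρ = ρ^{−σ₁} E(ρ·) − E` -/

/-- `G_ρ(x) = ρ^{−σ₁} E(ρx) − E(x)`. [cite: Hilberdink2005, §3] -/
def dilErr (P : BeurlingPrimes) (a σ₁ ρ : ℝ) : ℝ → ℂ :=
  fun x ↦ ((ρ ^ (-σ₁) : ℝ) : ℂ) * errN P a (ρ * x) - errN P a x

/-- `G_ρ` is measurable. [folklore] -/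
theorem measurable_dilErr (P : BeurlingPrimes) (a σ₁ ρ : ℝ) : Measurable (dilErr P a σ₁ ρ) :=
  (measurable_const.mul ((measurable_errN a).comp (measurable_const.mul measurable_id))).sub
    (measurable_errN a)

/-- `G_ρ(x) = 0` for `0 < x ≤ 1/ρ` (`ρ ≥ 1`). [folklore] -/
theorem dilErr_of_le (hρ : 1 ≤ ρ) {x : ℝ} (hx0 : 0 ≤ x) (hx : ρ * x ≤ 1) : dilErr P a σ₁ ρ x = 0 := by
  have hx1 : x ≤ 1 := by nlinarith
  simp [dilErr, errN_of_le_one hx, errN_of_le_one hx1]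

/-- **`‖G_ρ(x)‖ ≤ 3C x^θ`** for `x > 0`, when `|N_P(x) − ax| ≤ Cx^θ`, `1 ≤ ρ ≤ 2`, `0 ≤ θ ≤ σ₁`.
[folklore] -/
theorem norm_dilErr_le (hN : ∀ x : ℝ, 1 ≤ x → |(P.intCount x : ℝ) - a * x| ≤ C * x ^ θ)
    (hθ0 : 0 ≤ θ) (hθ1 : θ ≤ 1) (hθσ : θ ≤ σ₁) (hρ : 1 ≤ ρ) (hρ2 : ρ ≤ 2) {x : ℝ} (hx : 0 < x) :
    ‖dilErr P a σ₁ ρ x‖ ≤ 3 * C * x ^ θ := by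
  have hC := const_nonneg hN
  have hρ0 : 0 < ρ := by linarith
  have h1 : ‖errN P a (ρ * x)‖ ≤ C * (ρ * x) ^ θ := norm_errN_le hN (by positivity)
  have h2 : ‖errN P a x‖ ≤ C * x ^ θ := norm_errN_le hN hx
  have hρθ : (ρ * x) ^ θ ≤ 2 * x ^ θ := by
    rw [Real.mul_rpow hρ0.le hx.le]
    refine mul_le_mul_of_nonneg_right ?_ (Real.rpow_nonneg hx.le _)
    calc ρ ^ θ ≤ 2 ^ θ := Real.rpow_le_rpow hρ0.le hρ2 hθ0
      _ ≤ 2 ^ (1 : ℝ) := Real.rpow_le_rpow_of_exponent_le (by norm_num) (by linarith)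
      _ = 2 := Real.rpow_one 2
  have hu : ρ ^ (-σ₁) ≤ 1 := Real.rpow_le_one_of_one_le_of_nonpos hρ (by linarith)
  have hu0 : 0 ≤ ρ ^ (-σ₁) := Real.rpow_nonneg hρ0.le _
  unfold dilErr
  calc ‖((ρ ^ (-σ₁) : ℝ) : ℂ) * errN P a (ρ * x) - errN P a x‖
      ≤ ‖((ρ ^ (-σ₁) : ℝ) : ℂ) * errN P a (ρ * x)‖ + ‖errN P a x‖ := norm_sub_le _ _
    _ = ρ ^ (-σ₁) * ‖errN P a (ρ * x)‖ + ‖errN P a x‖ := by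
        rw [norm_mul, Complex.norm_real, Real.norm_eq_abs, abs_of_nonneg hu0]
    _ ≤ 1 * (C * (2 * x ^ θ)) + C * x ^ θ := by
        gcongr
        exact h1.trans (mul_le_mul_of_nonneg_left hρθ hC)
    _ = 3 * C * x ^ θ := by ring

/-- `x ↦ ‖G_ρ(x)‖² x^{−2σ₁−1}` is integrable on `(0, ∞)` (it vanishes on `(0, 1/2]` and is
`≤ 9C² x^{2θ−2σ₁−1}` with `2θ − 2σ₁ − 1 < −1`). [folklore] -/
theorem integrableOn_norm_sq_dilErr (hN : ∀ x : ℝ, 1 ≤ x → |(P.intCount x : ℝ) - a * x| ≤ C * x ^ θ)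
    (hθ0 : 0 ≤ θ) (hθ1 : θ ≤ 1) (hθσ : θ < σ₁) (hρ : 1 ≤ ρ) (hρ2 : ρ ≤ 2) :
    IntegrableOn (fun x : ℝ ↦ ‖dilErr P a σ₁ ρ x‖ ^ 2 * x ^ (2 * (-σ₁) - 1)) (Ioi 0) := by
  have hC := const_nonneg hN
  have hmeas : AEStronglyMeasurable (fun x : ℝ ↦ ‖dilErr P a σ₁ ρ x‖ ^ 2 * x ^ (2 * (-σ₁) - 1)) volume :=
    (((measurable_dilErr P a σ₁ ρ).norm.pow_const 2).mul (measurable_id.pow_const _)).aestronglyMeasurable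
  have hsplit : Ioi (0 : ℝ) = Ioc 0 (1 / 2) ∪ Ioi (1 / 2) := (Ioc_union_Ioi_eq_Ioi (by norm_num)).symm
  rw [hsplit]
  refine IntegrableOn.union ?_ ?_
  · -- the function vanishes on `(0, 1/2]`
    refine (integrableOn_zero).congr_fun (fun x hx ↦ ?_) measurableSet_Ioc
    have : ρ * x ≤ 1 := by nlinarith [hx.1, hx.2]
    rw [dilErr_of_le hρ hx.1.le this, norm_zero]
    simp
  · have hexp : 2 * θ - 2 * σ₁ - 1 < -1 := by linarith
    refine Integrable.mono' ((integrableOn_Ioi_rpow_of_lt hexp (by norm_num : (0 : ℝ) < 1 / 2)).const_mul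
      ((3 * C) ^ 2)) hmeas.restrict ?_
    rw [ae_restrict_iff' measurableSet_Ioi]
    refine Eventually.of_forall fun x hx ↦ ?_
    have hx0 : 0 < x := lt_trans (by norm_num) hx
    have hb := norm_dilErr_le hN hθ0 hθ1 hθσ.le hρ hρ2 hx0 (P := P) (a := a)
    rw [Real.norm_eq_abs, abs_of_nonneg (by positivity)]
    have hx2 : 0 ≤ x ^ (2 * (-σ₁) - 1) := Real.rpow_nonneg hx0.le _
    calc ‖dilErr P a σ₁ ρ x‖ ^ 2 * x ^ (2 * (-σ₁) - 1) ≤ (3 * C * x ^ θ) ^ 2 * x ^ (2 * (-σ₁) - 1) := by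
          gcongr
      _ = (3 * C) ^ 2 * x ^ (2 * θ - 2 * σ₁ - 1) := by
          rw [mul_pow, sq (x ^ θ), ← Real.rpow_add hx0, mul_assoc, ← Real.rpow_add hx0,
            show θ + θ + (2 * -σ₁ - 1) = 2 * θ - 2 * σ₁ - 1 by ring]

/-- The Mellin integral of `G_ρ` converges on `Re = −σ₁` (indeed for `−Re > θ`). [folklore] -/
theorem mellinConvergent_dilErr (hN : ∀ x : ℝ, 1 ≤ x → |(P.intCount x : ℝ) - a * x| ≤ C * x ^ θ)
    (hρ : 0 < ρ) {w : ℂ} (hw : θ < -w.re) : MellinConvergent (dilErr P a σ₁ ρ) w := by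
  have h1 : MellinConvergent (errN P a) w := by
    have := mellinConvergent_errN hN (s := -w) (by simpa using hw)
    rwa [neg_neg] at this
  have h2 : MellinConvergent (fun x ↦ errN P a (ρ * x)) w := (MellinConvergent.comp_mul_left hρ).mpr h1
  unfold MellinConvergent at h1 h2 ⊢
  have h3 : IntegrableOn ((((ρ ^ (-σ₁) : ℝ) : ℂ) • fun t : ℝ ↦ (t : ℂ) ^ (w - 1) • errN P a (ρ * t)) -
      fun t : ℝ ↦ (t : ℂ) ^ (w - 1) • errN P a t) (Ioi 0) := (h2.smul (((ρ ^ (-σ₁) : ℝ) : ℂ))).sub h1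
  refine h3.congr_fun (fun x _ ↦ ?_) measurableSet_Ioi
  simp only [Pi.smul_apply, Pi.sub_apply, smul_eq_mul, dilErr]
  ring

/-- **`mellin G_ρ w = (ρ^{−σ₁} ρ^{−w} − 1) · mellin E w`** (change of variables). [folklore] -/
theorem mellin_dilErr (hN : ∀ x : ℝ, 1 ≤ x → |(P.intCount x : ℝ) - a * x| ≤ C * x ^ θ)
    (hρ : 0 < ρ) {w : ℂ} (hw : θ < -w.re) :
    mellin (dilErr P a σ₁ ρ) w = (((ρ ^ (-σ₁) : ℝ) : ℂ) * (ρ : ℂ) ^ (-w) - 1) * mellin (errN P a) w := by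
  have h1 : MellinConvergent (errN P a) w := by
    have := mellinConvergent_errN hN (s := -w) (by simpa using hw)
    rwa [neg_neg] at this
  have h2 : MellinConvergent (fun x ↦ errN P a (ρ * x)) w := (MellinConvergent.comp_mul_left hρ).mpr h1
  have hscaled : mellin (fun x ↦ errN P a (ρ * x)) w = (ρ : ℂ) ^ (-w) * mellin (errN P a) w := by
    rw [mellin_comp_mul_left _ _ hρ, smul_eq_mul]
  unfold mellin at *
  unfold MellinConvergent at h1 h2
  have hfun : (fun t : ℝ ↦ (t : ℂ) ^ (w - 1) • dilErr P a σ₁ ρ t) = fun t : ℝ ↦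
      ((ρ ^ (-σ₁) : ℝ) : ℂ) • ((t : ℂ) ^ (w - 1) • errN P a (ρ * t)) - (t : ℂ) ^ (w - 1) • errN P a t := by
    funext t
    simp only [dilErr, smul_eq_mul]
    ring
  have h2' : Integrable (fun t : ℝ ↦ ((ρ ^ (-σ₁) : ℝ) : ℂ) • ((t : ℂ) ^ (w - 1) • errN P a (ρ * t)))
      (volume.restrict (Ioi 0)) := by
    have h := h2.smul (((ρ ^ (-σ₁) : ℝ) : ℂ))
    exact h
  rw [hfun, integral_sub h2' h1, integral_smul, smul_eq_mul, hscaled]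
  ring

/-- On the line `Re w = −σ₁` the factor is `ρ^{−iτ} − 1`:
`ρ^{−σ₁} ρ^{−(−σ₁+iτ)} − 1 = exp(−iτ log ρ) − 1`. [folklore] -/
theorem factor_eq (hρ : 0 < ρ) (τ : ℝ) :
    ((ρ ^ (-σ₁) : ℝ) : ℂ) * (ρ : ℂ) ^ (-((-σ₁ : ℂ) + τ * I)) - 1 =
      Complex.exp (I * ((-(τ * Real.log ρ) : ℝ) : ℂ)) - 1 := by
  congr 1
  have hρ0 : (ρ : ℂ) ≠ 0 := ofReal_ne_zero.mpr hρ.ne'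
  rw [Complex.ofReal_cpow hρ.le, cpow_def_of_ne_zero hρ0, cpow_def_of_ne_zero hρ0, ← Complex.exp_add,
    ← Complex.ofReal_log hρ.le]
  congr 1
  push_cast
  ring

/-- **`‖ρ^{−iτ} − 1‖² ≤ 4 (|τ| h)^{2γ}`** for `ρ = e^h`, `0 ≤ γ ≤ 1` (from `‖e^{ix} − 1‖ ≤ min(|x|, 2)`).
[folklore] -/
theorem norm_sq_factor_le {h γ : ℝ} (hh : 0 ≤ h) (hγ0 : 0 ≤ γ) (hγ1 : γ ≤ 1) (τ : ℝ) :
    ‖Complex.exp (I * ((-(τ * h) : ℝ) : ℂ)) - 1‖ ^ 2 ≤ 4 * (|τ| * h) ^ (2 * γ) := by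
  set u : ℝ := ‖Complex.exp (I * ((-(τ * h) : ℝ) : ℂ)) - 1‖ with hu
  have hu0 : 0 ≤ u := norm_nonneg _
  have hu1 : u ≤ |τ| * h := by
    have := Real.norm_exp_I_mul_ofReal_sub_one_le (x := -(τ * h))
    rw [Real.norm_eq_abs, abs_neg, abs_mul, abs_of_nonneg hh] at this
    exact this
  have hu2 : u ≤ 2 := by
    calc u ≤ ‖Complex.exp (I * ((-(τ * h) : ℝ) : ℂ))‖ + ‖(1 : ℂ)‖ := norm_sub_le _ _
      _ = 2 := by rw [Complex.norm_exp_I_mul_ofReal, norm_one]; norm_num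
  have hv0 : 0 ≤ |τ| * h := by positivity
  rcases le_or_gt 1 (|τ| * h) with hv | hv
  · -- `|τ|h ≥ 1`: `u² ≤ 4 ≤ 4 (|τ|h)^{2γ}`
    have : 1 ≤ (|τ| * h) ^ (2 * γ) := Real.one_le_rpow hv (by linarith)
    nlinarith
  · -- `|τ|h < 1`: `u² ≤ u^{2γ} ≤ (|τ|h)^{2γ}`
    have hule : u ≤ 1 := by linarith
    have h1 : u ^ 2 ≤ u ^ (2 * γ) := by
      rcases eq_or_lt_of_le hu0 with h0 | h0
      · rw [← h0]
        simp only [ne_eq, OfNat.ofNat_ne_zero, not_false_eq_true, zero_pow]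
        exact Real.rpow_nonneg le_rfl _
      · rw [← Real.rpow_natCast]
        exact Real.rpow_le_rpow_of_exponent_ge h0 hule (by push_cast; linarith)
    have h2 : u ^ (2 * γ) ≤ (|τ| * h) ^ (2 * γ) := Real.rpow_le_rpow hu0 hu1 (by linarith)
    have h3 : 0 ≤ (|τ| * h) ^ (2 * γ) := Real.rpow_nonneg hv0 _
    linarith

/-! ### The Plancherel upper bound -/

/-- **The upper bound.** If `‖mellin E (−σ₁ + iτ)‖ ≤ K(1 + |τ|)^{ε−1}` for all real `τ`, and
`0 ≤ γ ≤ 1`, `2γ + 2ε < 1`, `ρ = e^h` with `0 < h`, then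
`2π ∫₀^∞ ‖G_ρ(x)‖² x^{−2σ₁−1} dx ≤ 4K² (∫(1+|τ|)^{2γ+2ε−2}dτ) · h^{2γ}` (Mellin–Plancherel and
`‖ρ^{−iτ} − 1‖² ≤ 4(|τ|h)^{2γ} ≤ 4h^{2γ}(1+|τ|)^{2γ}`). [cite: Hilberdink2005, §3] -/
theorem integral_norm_sq_dilErr_le (hN : ∀ x : ℝ, 1 ≤ x → |(P.intCount x : ℝ) - a * x| ≤ C * x ^ θ)
    (hθ0 : 0 ≤ θ) (hθ1 : θ ≤ 1) (hθσ : θ < σ₁) {ε γ K h : ℝ} (hε : 0 < ε) (hγ0 : 0 ≤ γ) (hγ1 : γ ≤ 1)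
    (hγε : 2 * γ + 2 * ε < 1) (hh : 0 < h) (hh1 : h ≤ 1 / 2)
    (hK : ∀ τ : ℝ, ‖mellin (errN P a) (-σ₁ + τ * I)‖ ≤ K * (1 + |τ|) ^ (ε - 1)) :
    2 * π * ∫ x in Ioi (0 : ℝ), ‖dilErr P a σ₁ (Real.exp h) x‖ ^ 2 * x ^ (2 * (-σ₁) - 1) ≤
      4 * K ^ 2 * (∫ τ : ℝ, (1 + |τ|) ^ (-(2 - 2 * γ - 2 * ε))) * h ^ (2 * γ) := by
  set ρ : ℝ := Real.exp h with hρdef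
  have hρ0 : 0 < ρ := Real.exp_pos h
  have hρ1 : 1 ≤ ρ := Real.one_le_exp hh.le
  have hρ2 : ρ ≤ 2 := by
    have h1 := Real.abs_exp_sub_one_sub_id_le (x := h) (by rw [abs_of_pos hh]; linarith)
    have := (abs_le.mp h1).2
    rw [hρdef]; nlinarith
  have hlogρ : Real.log ρ = h := by rw [hρdef, Real.log_exp]
  -- Mellin–Plancherel
  have hmc : MellinConvergent (dilErr P a σ₁ ρ) ((-σ₁ : ℝ) : ℂ) :=
    mellinConvergent_dilErr hN hρ0 (by simp; linarith)
  have hP := Literature.Analysis.FunctionSpaces.integral_norm_sq_mellin_eq hmc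
    (integrableOn_norm_sq_dilErr hN hθ0 hθ1 hθσ hρ1 hρ2)
  rw [← hP.2]
  -- pointwise bound on the Mellin side
  set r : ℝ := 2 - 2 * γ - 2 * ε with hr
  have hr1 : 1 < r := by rw [hr]; linarith
  have hint : Integrable fun τ : ℝ ↦ (1 + |τ|) ^ (-r) := by
    -- Mathlib `integrable_one_add_norm` (as in the tree's `NymanBeurlingProofs.lean`)
    have h := integrable_one_add_norm (E := ℝ) (μ := volume) (r := r) (by simpa using hr1)
    simpa [Real.norm_eq_abs] using h
  have hK0 : 0 ≤ K := by
    have := (norm_nonneg _).trans (hK 0)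
    simpa using this
  have hpt : ∀ τ : ℝ, ‖mellin (dilErr P a σ₁ ρ) ((-σ₁ : ℝ) + τ * I)‖ ^ 2 ≤
      4 * K ^ 2 * h ^ (2 * γ) * (1 + |τ|) ^ (-r) := by
    intro τ
    have hw : θ < -((-σ₁ : ℂ) + τ * I).re := by simp; linarith
    have hmel := mellin_dilErr (P := P) (a := a) (σ₁ := σ₁) hN hρ0 hw
    have hw' : ((-σ₁ : ℝ) : ℂ) + τ * I = (-σ₁ : ℂ) + τ * I := by push_cast; ring
    rw [hw', hmel, norm_mul, mul_pow, factor_eq hρ0 τ, hlogρ]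
    have hf := norm_sq_factor_le hh.le hγ0 hγ1 τ
    have hm := hK τ
    have hm0 : 0 ≤ ‖mellin (errN P a) (-σ₁ + τ * I)‖ := norm_nonneg _
    have hm2 : ‖mellin (errN P a) (-σ₁ + τ * I)‖ ^ 2 ≤ (K * (1 + |τ|) ^ (ε - 1)) ^ 2 := by gcongr
    have hτ0 : 0 ≤ 1 + |τ| := by positivity
    -- `(|τ|h)^{2γ} ≤ h^{2γ} (1+|τ|)^{2γ}` and the exponent bookkeeping
    have h1 : (|τ| * h) ^ (2 * γ) ≤ h ^ (2 * γ) * (1 + |τ|) ^ (2 * γ) := by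
      rw [mul_comm (|τ|) h, Real.mul_rpow hh.le (abs_nonneg τ)]
      gcongr
      linarith [abs_nonneg τ]
    have h2 : (1 + |τ|) ^ (2 * γ) * ((1 + |τ|) ^ (ε - 1)) ^ 2 = (1 + |τ|) ^ (-r) := by
      rw [← Real.rpow_natCast, ← Real.rpow_mul hτ0, ← Real.rpow_add (by positivity)]
      congr 1; rw [hr]; push_cast; ring
    calc ‖Complex.exp (I * ((-(τ * h) : ℝ) : ℂ)) - 1‖ ^ 2 * ‖mellin (errN P a) (-σ₁ + τ * I)‖ ^ 2
        ≤ (4 * (|τ| * h) ^ (2 * γ)) * (K * (1 + |τ|) ^ (ε - 1)) ^ 2 :=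
          mul_le_mul hf hm2 (by positivity) (by positivity)
      _ ≤ (4 * (h ^ (2 * γ) * (1 + |τ|) ^ (2 * γ))) * (K * (1 + |τ|) ^ (ε - 1)) ^ 2 := by gcongr
      _ = 4 * K ^ 2 * h ^ (2 * γ) * ((1 + |τ|) ^ (2 * γ) * ((1 + |τ|) ^ (ε - 1)) ^ 2) := by ring
      _ = 4 * K ^ 2 * h ^ (2 * γ) * (1 + |τ|) ^ (-r) := by rw [h2]
  have hle := integral_mono hP.1 (hint.const_mul (4 * K ^ 2 * h ^ (2 * γ))) hpt
  rw [integral_const_mul] at hle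
  calc ∫ τ : ℝ, ‖mellin (dilErr P a σ₁ ρ) ((-σ₁ : ℝ) + τ * I)‖ ^ 2
      ≤ 4 * K ^ 2 * h ^ (2 * γ) * ∫ τ : ℝ, (1 + |τ|) ^ (-r) := hle
    _ = 4 * K ^ 2 * (∫ τ : ℝ, (1 + |τ|) ^ (-r)) * h ^ (2 * γ) := by ring

end Hilberdink

end Literature.NumberTheory.BeurlingPrimes
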